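import Mathlib
import HarnessLib

/-!
# Crux `NNLinearDegreeCofactorHard` (stmt-ValiantsHypothesis-23918), line `internal_cofactor`, stub S2b (ii):
# the ADAPTIVE block test lemma (unit (B‴-a) of `Lines/internal_cofactor-S2b-D3plan.md`)

The landed block test lemma `BlockTests.card_filter_blockAvoid_le` (p592179) prices forbidden code SETS at a FIXED set of
pair positions.  The heart (D‴) of the exponent-2 rung S11 (stmt-ValiantsHypothesis-24468) needs the tests at PAST-CHOSEN
pairs: for a bit string `v : Fin (2J) → Bool` read pair by pair (pair `j` = bits `2j, 2j+1`), a forbidden code set `Φ j v`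
depending on `v` only through the bits below `2j`, and a word counts as TESTED at pair `j` when `#(Φ j v) ≥ f` — a property
of its own past.  The naive «≥ r tests» induction loses a factor `2` per pair; the supermartingale does not, and in counting
form it is the WEIGHTED statement

* `sum_weight_adaptiveAvoid_le` — for every `A` of words avoiding `Φ j v` at every pair `j < J`:
  `Σ_{v ∈ A} 4^{τ(v)} · (4 − f)^{J − τ(v)} ≤ (4 · (4 − f))^J`, `τ(v) := #{j < J : f ≤ #(Φ j v)}`
  (induction on the number of pairs read, peeling the last pair inside the fixed word type by blanking its two bits: on each
  fibre the `≤ 4 − #Φ` completions all have the same past, hence the same test status and the same earlier tests);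
* `card_adaptiveAvoid_le` — hence if every `v ∈ A` is tested at least `r` times, `#A · 4^r ≤ (4 − f)^r · 4^J` (`f ≤ 3`):
  each adaptive test of strength `f` costs a factor `1 − f/4`, exactly as a fixed one.

Honest framing: elementary counting (measure-agnostic infrastructure); nothing here bears on S11, S2b, the crux or VP ≠ VNP.
No definitions, no named facts.
-/

-- Sub = Summit single-conjunct layout: the duplicated namespace component is mandated by the tree.
set_option linter.dupNamespace false

namespace Summit.ValiantsHypothesis.ValiantsHypothesis.Theorems.FifoMatching.NNLinearDegreeCofactorHard.AdaptiveBlockTests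

open Finset

variable {J : ℕ}

/-- Blanking pair `t` does not change the bits below `2t`. [folklore] -/
theorem blank_apply_of_lt (t : ℕ) (v : Fin (2 * J) → Bool) (i : Fin (2 * J)) (hi : i.val < 2 * t) :
    (fun k : Fin (2 * J) => if k.val / 2 = t then false else v k) i = v i := by
  simp only
  rw [if_neg (by omega)]

/-- A word is determined by its blanking at pair `t` and its code at pair `t`. [folklore] -/
theorem eq_of_blank_eq_of_code_eq (t : ℕ) {v w : Fin (2 * J) → Bool}
    (hb : (fun k : Fin (2 * J) => if k.val / 2 = t then false else v k)
      = (fun k : Fin (2 * J) => if k.val / 2 = t then false else w k))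
    (hc : ((if h : 2 * t < 2 * J then v ⟨2 * t, h⟩ else false),
            (if h : 2 * t + 1 < 2 * J then v ⟨2 * t + 1, h⟩ else false))
        = ((if h : 2 * t < 2 * J then w ⟨2 * t, h⟩ else false),
            (if h : 2 * t + 1 < 2 * J then w ⟨2 * t + 1, h⟩ else false))) :
    v = w := by
  funext k
  by_cases hk : k.val / 2 = t
  · -- `k` is one of the two bits of pair `t`
    have hk2 : k.val = 2 * t ∨ k.val = 2 * t + 1 := by omega
    rw [Prod.mk.injEq] at hc
    rcases hk2 with h | h
    · have hlt : 2 * t < 2 * J := by have := k.isLt; omega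
      have e := hc.1
      rw [dif_pos hlt, dif_pos hlt] at e
      have hk' : k = ⟨2 * t, hlt⟩ := Fin.ext h
      rw [hk']; exact e
    · have hlt : 2 * t + 1 < 2 * J := by have := k.isLt; omega
      have e := hc.2
      rw [dif_pos hlt, dif_pos hlt] at e
      have hk' : k = ⟨2 * t + 1, hlt⟩ := Fin.ext h
      rw [hk']; exact e
  · have e := congrFun hb k
    simp only [if_neg hk] at e
    exact e

/-- **The weighted adaptive test lemma (supermartingale in counting form).**  See the module docstring; this is the
internal version for the first `t` pairs, on words blank above pair `t`. [folklore] -/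
theorem sum_weight_le_of_blank (f : ℕ) (hf : f ≤ 4)
    (Φ : ℕ → (Fin (2 * J) → Bool) → Finset (Bool × Bool))
    (hΦ : ∀ j (v w : Fin (2 * J) → Bool), (∀ i : Fin (2 * J), i.val < 2 * j → v i = w i) → Φ j v = Φ j w) :
    ∀ t : ℕ, ∀ A : Finset (Fin (2 * J) → Bool),
      (∀ v ∈ A, ∀ i : Fin (2 * J), 2 * t ≤ i.val → v i = false) →
      (∀ v ∈ A, ∀ j < t, ((if h : 2 * j < 2 * J then v ⟨2 * j, h⟩ else false),
            (if h : 2 * j + 1 < 2 * J then v ⟨2 * j + 1, h⟩ else false)) ∉ Φ j v) →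
      ∑ v ∈ A, 4 ^ ((range t).filter fun j => f ≤ (Φ j v).card).card
          * (4 - f) ^ (t - ((range t).filter fun j => f ≤ (Φ j v).card).card)
        ≤ (4 * (4 - f)) ^ t := by
  classical
  intro t
  induction t with
  | zero =>
    intro A hblank _
    -- `A ⊆ {the all-false word}`
    have hsub : A ⊆ {fun _ => false} := by
      intro v hv
      rw [mem_singleton]
      funext i
      exact hblank v hv i (by omega)
    calc ∑ v ∈ A, 4 ^ ((range 0).filter fun j => f ≤ (Φ j v).card).card
            * (4 - f) ^ (0 - ((range 0).filter fun j => f ≤ (Φ j v).card).card)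
        = ∑ v ∈ A, 1 := by simp
      _ = A.card := by simp
      _ ≤ ({(fun _ => false : Fin (2 * J) → Bool)} : Finset _).card := card_le_card hsub
      _ = (4 * (4 - f)) ^ 0 := by simp
  | succ t ih =>
    intro A hblank havoid
    -- blank pair `t`
    set bl : (Fin (2 * J) → Bool) → (Fin (2 * J) → Bool) :=
      fun v k => if k.val / 2 = t then false else v k with hbl
    set B := A.image bl with hB
    -- the image is blank above `t` and avoids the pairs `< t`
    have hBblank : ∀ w ∈ B, ∀ i : Fin (2 * J), 2 * t ≤ i.val → w i = false := by
      intro w hw i hi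
      rw [hB, mem_image] at hw
      obtain ⟨v, hv, rfl⟩ := hw
      simp only [hbl]
      by_cases h : i.val / 2 = t
      · rw [if_pos h]
      · rw [if_neg h]; exact hblank v hv i (by omega)
    have hpast : ∀ v : Fin (2 * J) → Bool, ∀ j ≤ t, Φ j (bl v) = Φ j v := by
      intro v j hj
      exact hΦ j _ _ fun i hi => blank_apply_of_lt t v i (by omega)
    have hcode_bl : ∀ v : Fin (2 * J) → Bool, ∀ j < t,
        ((if h : 2 * j < 2 * J then bl v ⟨2 * j, h⟩ else false),
          (if h : 2 * j + 1 < 2 * J then bl v ⟨2 * j + 1, h⟩ else false))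
        = ((if h : 2 * j < 2 * J then v ⟨2 * j, h⟩ else false),
          (if h : 2 * j + 1 < 2 * J then v ⟨2 * j + 1, h⟩ else false)) := by
      intro v j hj
      congr 1
      · split_ifs with h
        · exact blank_apply_of_lt t v _ (by simp; omega)
        · rfl
      · split_ifs with h
        · exact blank_apply_of_lt t v _ (by simp; omega)
        · rfl
    have hBavoid : ∀ w ∈ B, ∀ j < t, ((if h : 2 * j < 2 * J then w ⟨2 * j, h⟩ else false),
        (if h : 2 * j + 1 < 2 * J then w ⟨2 * j + 1, h⟩ else false)) ∉ Φ j w := by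
      intro w hw j hj
      rw [hB, mem_image] at hw
      obtain ⟨v, hv, rfl⟩ := hw
      rw [hcode_bl v j hj, hpast v j hj.le]
      exact havoid v hv j (by omega)
    have hIH := ih B hBblank hBavoid
    -- test counts: the first `t` tests of `v` are those of `bl v`; the `(t+1)`-st is past-determined
    have htests : ∀ v : Fin (2 * J) → Bool,
        ((range (t + 1)).filter fun j => f ≤ (Φ j v).card).card
          = ((range t).filter fun j => f ≤ (Φ j (bl v)).card).card + (if f ≤ (Φ t (bl v)).card then 1 else 0) := by
      intro v
      rw [Finset.range_add_one, filter_insert]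
      have hnot : t ∉ (range t).filter fun j => f ≤ (Φ j v).card := by simp
      have heq : ((range t).filter fun j => f ≤ (Φ j v).card) = (range t).filter fun j => f ≤ (Φ j (bl v)).card := by
        refine filter_congr fun j hj => ?_
        rw [mem_range] at hj
        rw [hpast v j hj.le]
      rw [hpast v t le_rfl]
      split_ifs with h
      · rw [card_insert_of_notMem hnot, heq]
      · rw [heq]; rfl
    -- regroup the sum along the fibres of `bl`
    have hmaps : ∀ v ∈ A, bl v ∈ B := fun v hv => by rw [hB]; exact mem_image_of_mem _ hv
    rw [← sum_fiberwise_of_maps_to hmaps]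
    -- bound each fibre by `4 (4 − f)` times the weight of its base point
    have hfibre : ∀ w ∈ B,
        ∑ v ∈ A.filter (fun v => bl v = w),
            4 ^ ((range (t + 1)).filter fun j => f ≤ (Φ j v).card).card
              * (4 - f) ^ (t + 1 - ((range (t + 1)).filter fun j => f ≤ (Φ j v).card).card)
          ≤ 4 * (4 - f) * (4 ^ ((range t).filter fun j => f ≤ (Φ j w).card).card
              * (4 - f) ^ (t - ((range t).filter fun j => f ≤ (Φ j w).card).card)) := by
      intro w hw
      -- all words of the fibre have the same weight
      have hconst : ∀ v ∈ A.filter (fun v => bl v = w),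
          4 ^ ((range (t + 1)).filter fun j => f ≤ (Φ j v).card).card
              * (4 - f) ^ (t + 1 - ((range (t + 1)).filter fun j => f ≤ (Φ j v).card).card)
            = 4 ^ (((range t).filter fun j => f ≤ (Φ j w).card).card + (if f ≤ (Φ t w).card then 1 else 0))
              * (4 - f) ^ (t + 1 - (((range t).filter fun j => f ≤ (Φ j w).card).card
                + (if f ≤ (Φ t w).card then 1 else 0))) := by
        intro v hv
        rw [mem_filter] at hv
        rw [htests v, hv.2]
      rw [sum_congr rfl hconst, sum_const, smul_eq_mul]
      -- the fibre has at most `4 − #(Φ t w)` elements: the code at pair `t` is injective on it and avoids `Φ t w`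
      have hcard : (A.filter fun v => bl v = w).card ≤ 4 - (Φ t w).card := by
        have hinj : Set.InjOn (fun v : Fin (2 * J) → Bool =>
            ((if h : 2 * t < 2 * J then v ⟨2 * t, h⟩ else false),
              (if h : 2 * t + 1 < 2 * J then v ⟨2 * t + 1, h⟩ else false)))
            (A.filter fun v => bl v = w : Set (Fin (2 * J) → Bool)) := by
          intro v hv v' hv' hvv'
          rw [mem_coe, mem_filter] at hv hv'
          exact eq_of_blank_eq_of_code_eq t (by show bl v = bl v'; rw [hv.2, hv'.2]) hvv'
        have hmaps' : ∀ v ∈ A.filter (fun v => bl v = w),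
            ((if h : 2 * t < 2 * J then v ⟨2 * t, h⟩ else false),
              (if h : 2 * t + 1 < 2 * J then v ⟨2 * t + 1, h⟩ else false)) ∈ (univ : Finset (Bool × Bool)) \ Φ t w := by
          intro v hv
          rw [mem_filter] at hv
          rw [mem_sdiff]
          refine ⟨mem_univ _, ?_⟩
          rw [← hv.2, hpast v t le_rfl]
          exact havoid v hv.1 t (Nat.lt_succ_self t)
        have h1 := card_le_card_of_injOn _ hmaps' hinj
        have h2 : ((univ : Finset (Bool × Bool)) \ Φ t w).card = 4 - (Φ t w).card := by
          rw [card_sdiff_of_subset (subset_univ _)]; simp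
        omega
      have htle : ((range t).filter fun j => f ≤ (Φ j w).card).card ≤ t := by
        calc ((range t).filter fun j => f ≤ (Φ j w).card).card ≤ (range t).card := card_filter_le _ _
          _ = t := card_range t
      set τ := ((range t).filter fun j => f ≤ (Φ j w).card).card with hτ
      by_cases htest : f ≤ (Φ t w).card
      · rw [if_pos htest]
        have hk : (A.filter fun v => bl v = w).card ≤ 4 - f := by omega
        have e : t + 1 - (τ + 1) = t - τ := by omega
        rw [e, pow_succ]
        calc (A.filter fun v => bl v = w).card * (4 ^ τ * 4 * (4 - f) ^ (t - τ))
            ≤ (4 - f) * (4 ^ τ * 4 * (4 - f) ^ (t - τ)) := Nat.mul_le_mul_right _ hk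
          _ = 4 * (4 - f) * (4 ^ τ * (4 - f) ^ (t - τ)) := by ring
      · rw [if_neg htest, add_zero]
        have hk : (A.filter fun v => bl v = w).card ≤ 4 := by omega
        have e : t + 1 - τ = (t - τ) + 1 := by omega
        rw [e, pow_succ]
        calc (A.filter fun v => bl v = w).card * (4 ^ τ * ((4 - f) ^ (t - τ) * (4 - f)))
            ≤ 4 * (4 ^ τ * ((4 - f) ^ (t - τ) * (4 - f))) := Nat.mul_le_mul_right _ hk
          _ = 4 * (4 - f) * (4 ^ τ * (4 - f) ^ (t - τ)) := by ring
    calc ∑ w ∈ B, ∑ v ∈ A.filter (fun v => bl v = w),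
            4 ^ ((range (t + 1)).filter fun j => f ≤ (Φ j v).card).card
              * (4 - f) ^ (t + 1 - ((range (t + 1)).filter fun j => f ≤ (Φ j v).card).card)
        ≤ ∑ w ∈ B, 4 * (4 - f) * (4 ^ ((range t).filter fun j => f ≤ (Φ j w).card).card
              * (4 - f) ^ (t - ((range t).filter fun j => f ≤ (Φ j w).card).card)) := sum_le_sum hfibre
      _ = 4 * (4 - f) * (∑ w ∈ B, 4 ^ ((range t).filter fun j => f ≤ (Φ j w).card).card
              * (4 - f) ^ (t - ((range t).filter fun j => f ≤ (Φ j w).card).card)) := by rw [mul_sum]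
      _ ≤ 4 * (4 - f) * (4 * (4 - f)) ^ t := Nat.mul_le_mul_left _ hIH
      _ = (4 * (4 - f)) ^ (t + 1) := by ring

/-- **The weighted adaptive test lemma.**  For every set `A` of bit strings of length `2J` avoiding, at every pair `j < J`,
a forbidden code set `Φ j v` that depends on `v` only through the bits below `2j`:
`Σ_{v ∈ A} 4^{τ(v)} (4 − f)^{J − τ(v)} ≤ (4 (4 − f))^J`, where `τ(v)` counts the pairs with `#(Φ j v) ≥ f`. [folklore] -/
theorem sum_weight_adaptiveAvoid_le (f : ℕ) (hf : f ≤ 4)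
    (Φ : ℕ → (Fin (2 * J) → Bool) → Finset (Bool × Bool))
    (hΦ : ∀ j (v w : Fin (2 * J) → Bool), (∀ i : Fin (2 * J), i.val < 2 * j → v i = w i) → Φ j v = Φ j w)
    (A : Finset (Fin (2 * J) → Bool))
    (hA : ∀ v ∈ A, ∀ j < J, ((if h : 2 * j < 2 * J then v ⟨2 * j, h⟩ else false),
        (if h : 2 * j + 1 < 2 * J then v ⟨2 * j + 1, h⟩ else false)) ∉ Φ j v) :
    ∑ v ∈ A, 4 ^ ((range J).filter fun j => f ≤ (Φ j v).card).card
        * (4 - f) ^ (J - ((range J).filter fun j => f ≤ (Φ j v).card).card)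
      ≤ (4 * (4 - f)) ^ J :=
  sum_weight_le_of_blank f hf Φ hΦ J A (fun _ _ i hi => absurd i.isLt (not_lt.2 hi)) hA

/-- **The adaptive block test lemma.**  If moreover every `v ∈ A` is tested (`#(Φ j v) ≥ f`) at `≥ r` pairs, then
`#A · 4^r ≤ (4 − f)^r · 4^J` (`f ≤ 3`): each adaptive test of strength `f` costs a factor `(4 − f)/4`. [folklore] -/
theorem card_adaptiveAvoid_le (f r : ℕ) (hf : f ≤ 3)
    (Φ : ℕ → (Fin (2 * J) → Bool) → Finset (Bool × Bool))
    (hΦ : ∀ j (v w : Fin (2 * J) → Bool), (∀ i : Fin (2 * J), i.val < 2 * j → v i = w i) → Φ j v = Φ j w)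
    (A : Finset (Fin (2 * J) → Bool))
    (hA : ∀ v ∈ A, ∀ j < J, ((if h : 2 * j < 2 * J then v ⟨2 * j, h⟩ else false),
        (if h : 2 * j + 1 < 2 * J then v ⟨2 * j + 1, h⟩ else false)) ∉ Φ j v)
    (hr : ∀ v ∈ A, r ≤ ((range J).filter fun j => f ≤ (Φ j v).card).card) :
    A.card * 4 ^ r ≤ (4 - f) ^ r * 4 ^ J := by
  have hW := sum_weight_adaptiveAvoid_le f (by omega) Φ hΦ A hA
  by_cases hrJ : J < r
  · -- then no word can have `r` tests: `A = ∅`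
    have hA0 : A = ∅ := by
      rw [eq_empty_iff_forall_notMem]
      intro v hv
      have h1 := hr v hv
      have h2 : ((range J).filter fun j => f ≤ (Φ j v).card).card ≤ J :=
        (card_filter_le _ _).trans (card_range J).le
      omega
    rw [hA0]; simp
  rw [not_lt] at hrJ
  have hpos : 0 < (4 - f) ^ (J - r) := Nat.pow_pos (by omega)
  -- each term of the weighted sum is at least `4^r (4−f)^{J−r}`
  have hterm : ∀ v ∈ A, 4 ^ r * (4 - f) ^ (J - r)
      ≤ 4 ^ ((range J).filter fun j => f ≤ (Φ j v).card).card
        * (4 - f) ^ (J - ((range J).filter fun j => f ≤ (Φ j v).card).card) := by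
    intro v hv
    set τ := ((range J).filter fun j => f ≤ (Φ j v).card).card with hτ
    have hτJ : τ ≤ J := (card_filter_le _ _).trans (card_range J).le
    have hrτ : r ≤ τ := hr v hv
    -- 4^r (4−f)^{J−r} = 4^r (4−f)^{τ−r} (4−f)^{J−τ} ≤ 4^r 4^{τ−r} (4−f)^{J−τ} = 4^τ (4−f)^{J−τ}
    have e1 : (4 - f) ^ (J - r) = (4 - f) ^ (τ - r) * (4 - f) ^ (J - τ) := by
      rw [← pow_add]; congr 1; omega
    have e2 : 4 ^ τ = 4 ^ r * 4 ^ (τ - r) := by rw [← pow_add]; congr 1; omega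
    rw [e1, e2]
    have h3 : (4 - f) ^ (τ - r) ≤ 4 ^ (τ - r) := Nat.pow_le_pow_left (by omega) _
    calc 4 ^ r * ((4 - f) ^ (τ - r) * (4 - f) ^ (J - τ))
        = (4 - f) ^ (τ - r) * (4 ^ r * (4 - f) ^ (J - τ)) := by ring
      _ ≤ 4 ^ (τ - r) * (4 ^ r * (4 - f) ^ (J - τ)) := Nat.mul_le_mul_right _ h3
      _ = 4 ^ r * 4 ^ (τ - r) * (4 - f) ^ (J - τ) := by ring
  have hsum : A.card * (4 ^ r * (4 - f) ^ (J - r)) ≤ (4 * (4 - f)) ^ J := by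
    calc A.card * (4 ^ r * (4 - f) ^ (J - r)) = ∑ v ∈ A, 4 ^ r * (4 - f) ^ (J - r) := by
          rw [sum_const, smul_eq_mul]
      _ ≤ _ := sum_le_sum hterm
      _ ≤ (4 * (4 - f)) ^ J := hW
  -- cancel `(4−f)^{J−r}`
  have e : (4 * (4 - f)) ^ J = (4 - f) ^ r * 4 ^ J * (4 - f) ^ (J - r) := by
    rw [mul_pow]
    have : (4 - f) ^ J = (4 - f) ^ r * (4 - f) ^ (J - r) := by rw [← pow_add]; congr 1; omega
    rw [this]; ring
  rw [e] at hsum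
  have : A.card * 4 ^ r * (4 - f) ^ (J - r) ≤ (4 - f) ^ r * 4 ^ J * (4 - f) ^ (J - r) := by
    calc A.card * 4 ^ r * (4 - f) ^ (J - r) = A.card * (4 ^ r * (4 - f) ^ (J - r)) := by ring
      _ ≤ _ := hsum
  exact Nat.le_of_mul_le_mul_right this hpos

end Summit.ValiantsHypothesis.ValiantsHypothesis.Theorems.FifoMatching.NNLinearDegreeCofactorHard.AdaptiveBlockTests
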